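import Mathlib
import HarnessLib
import Literature.MathematicalPhysics.QuantumLattice.KohnLuttinger
import Literature.MathematicalPhysics.QuantumLattice.KohnLuttingerFermiCurvePolar
import Literature.MathematicalPhysics.QuantumLattice.KohnLuttingerLindhardMeasurable
import Summits.HubbardSuperconductivity.HubbardSuperconductivity.Theorems.WeakCouplingBCSWcbcsKohnLuttingerB1gReduction

/-!
# The sublattice map and the folded cover of the Brillouin zone
# (KL-MARGIN-SCAN reader card «sublattice-duality», discharge part 1/·; cell gate-hubbard-kl, seat p4 g20)

The pure next-nearest-neighbour band `ε' = squareDispersion 0 t'` is the nearest-neighbour band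
`ε = squareDispersion t' 0` composed with the linear sublattice map `A k = (k₀ + k₁, k₀ - k₁)` (reader
hubbard-klscan-idea-3).  This file sets up the geometry used by the whole discharge:

* §1 `klslA` / `klslLin`: `A ∘ A = 2`, `|det A| = 2`, `A_* vol = ½ vol` (`map_klslA_volume`), `‖A k‖ = √2 ‖k‖`,
  `A_* μH[1] = (√2)⁻¹ μH[1]` (`map_klslA_hausdorff`), and the same for the affine pieces `A + c`;
* §2 the coordinate fold `klslWrap` (back to `[-π, π)`), `klslFold`, and the **folded cover** `klslCover = fold ∘ A`,
  a measurable two-to-one self-map of the zone under which every `2π`-periodic band is blind to the fold;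
* §3 the dispersion identities `ε'(k) = ε(A k)`, `ε(Φ k) = ε'(k)`, `ε(Φ k + A q) = ε'(k + q)`.

Honest framing: elementary linear algebra / measure scaling; nothing here asserts a margin, the window or superconductivity.
-/

noncomputable section

set_option linter.dupNamespace false

namespace Summit.HubbardSuperconductivity.HubbardSuperconductivity.Theorems

open MeasureTheory Real Set Literature.MathematicalPhysics.QuantumLattice
open scoped ENNReal Pointwise

/-! ### §1 The linear sublattice map `A` -/

/-- The sublattice map `A k = (k₀ + k₁, k₀ - k₁)` (`A = √2 ·` an orthogonal map, `A ∘ A = 2`). [folklore] -/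
def klslA (k : Momentum) : Momentum := WithLp.toLp 2 ![k 0 + k 1, k 0 - k 1]

/-- First component of `A k`. [folklore] -/
@[simp] theorem klslA_apply_zero (k : Momentum) : klslA k 0 = k 0 + k 1 := by simp [klslA]

/-- Second component of `A k`. [folklore] -/
@[simp] theorem klslA_apply_one (k : Momentum) : klslA k 1 = k 0 - k 1 := by simp [klslA]

/-- `A` is additive. [folklore] -/
theorem klslA_add (k k' : Momentum) : klslA (k + k') = klslA k + klslA k' := by
  ext i; fin_cases i <;> simp <;> ring

/-- `A` commutes with scalars. [folklore] -/
theorem klslA_smul (c : ℝ) (k : Momentum) : klslA (c • k) = c • klslA k := by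
  ext i; fin_cases i <;> simp <;> ring

/-- `A ∘ A = 2`. [folklore] -/
theorem klslA_klslA (k : Momentum) : klslA (klslA k) = (2 : ℝ) • k := by
  ext i; fin_cases i <;> simp <;> ring

/-- `A` as a linear map. [folklore] -/
def klslLin : Momentum →ₗ[ℝ] Momentum where
  toFun := klslA
  map_add' := klslA_add
  map_smul' := klslA_smul

/-- The linear map is `A`. [folklore] -/
@[simp] theorem klslLin_apply (k : Momentum) : klslLin k = klslA k := rfl

/-- `A ∘ A = 2 · id` as linear maps. [folklore] -/
theorem klslLin_comp_klslLin : klslLin ∘ₗ klslLin = (2 : ℝ) • LinearMap.id := by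
  ext k i
  simp [klslA_klslA]

/-- `|det A| = 2` (from `det (A ∘ A) = det (2 · id) = 4`). [folklore] -/
theorem abs_det_klslLin : |LinearMap.det klslLin| = 2 := by
  have h := LinearMap.det_comp klslLin klslLin
  rw [klslLin_comp_klslLin, LinearMap.det_smul, LinearMap.det_id, finrank_euclideanSpace_fin] at h
  have h4 : LinearMap.det klslLin ^ 2 = 4 := by nlinarith [h]
  have hprod : (|LinearMap.det klslLin| - 2) * (|LinearMap.det klslLin| + 2) = 0 := by
    nlinarith [sq_abs (LinearMap.det klslLin)]
  rcases mul_eq_zero.1 hprod with h0 | h0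
  · linarith
  · linarith [abs_nonneg (LinearMap.det klslLin)]

/-- `A` is continuous. [folklore] -/
theorem continuous_klslA : Continuous klslA :=
  klslLin.continuous_of_finiteDimensional

/-- `A` is measurable. [folklore] -/
theorem measurable_klslA : Measurable klslA := continuous_klslA.measurable

/-- `A` is injective. [folklore] -/
theorem klslA_injective : Function.Injective klslA := by
  intro k k' h
  have h2 : (2 : ℝ) • k = (2 : ℝ) • k' := by rw [← klslA_klslA, ← klslA_klslA, h]
  exact smul_right_injective Momentum two_ne_zero h2

/-- **`A` halves Lebesgue measure**: `A_* vol = ½ · vol` (`|det A| = 2`). [folklore] -/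
theorem map_klslA_volume : Measure.map klslA (volume : Measure Momentum) = (2 : ℝ≥0∞)⁻¹ • volume := by
  have hdet : LinearMap.det klslLin ≠ 0 := fun h => by
    have := abs_det_klslLin; rw [h, abs_zero] at this; norm_num at this
  have h := Measure.map_linearMap_addHaar_eq_smul_addHaar (volume : Measure Momentum) hdet
  have hcoe : ⇑klslLin = klslA := rfl
  rw [hcoe] at h
  rw [h, abs_inv, abs_det_klslLin, ENNReal.ofReal_inv_of_pos two_pos, ENNReal.ofReal_ofNat]

/-- `‖A k‖ = √2 ‖k‖`. [folklore] -/
theorem norm_klslA (k : Momentum) : ‖klslA k‖ = Real.sqrt 2 * ‖k‖ := by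
  rw [EuclideanSpace.norm_eq, EuclideanSpace.norm_eq, Fin.sum_univ_two, Fin.sum_univ_two,
    ← Real.sqrt_mul (by norm_num : (0:ℝ) ≤ 2)]
  congr 1
  simp only [Real.norm_eq_abs, sq_abs, klslA_apply_zero, klslA_apply_one]
  ring

/-- The normalised map `A/√2` is an isometry. [folklore] -/
theorem isometry_klslA_div : Isometry ⇑((Real.sqrt 2)⁻¹ • klslLin) := by
  refine AddMonoidHomClass.isometry_of_norm _ fun k => ?_
  have hs : 0 < Real.sqrt 2 := Real.sqrt_pos.2 two_pos
  rw [LinearMap.smul_apply, klslLin_apply, norm_smul, norm_inv, Real.norm_eq_abs, abs_of_pos hs, norm_klslA,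
    inv_mul_cancel_left₀ hs.ne']

/-- `A '' s = √2 • (A/√2 '' s)`. [folklore] -/
theorem image_klslA_eq_smul (s : Set Momentum) :
    klslA '' s = (Real.sqrt 2 : ℝ) • (⇑((Real.sqrt 2)⁻¹ • klslLin) '' s) := by
  have hs : Real.sqrt 2 ≠ 0 := (Real.sqrt_pos.2 two_pos).ne'
  rw [← Set.image_smul, Set.image_image]
  refine Set.image_congr' fun k => ?_
  simp only [LinearMap.smul_apply, klslLin_apply, smul_inv_smul₀ hs]

/-- **`A` stretches arc length by `√2`**: `μH[1] (A '' s) = √2 · μH[1] s`. [folklore] -/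
theorem hausdorffMeasure_image_klslA (s : Set Momentum) :
    μH[1] (klslA '' s) = ENNReal.ofReal (Real.sqrt 2) * μH[1] s := by
  have hs : (Real.sqrt 2 : ℝ) ≠ 0 := (Real.sqrt_pos.2 two_pos).ne'
  rw [image_klslA_eq_smul, Measure.hausdorffMeasure_smul₀ zero_le_one hs,
    isometry_klslA_div.hausdorffMeasure_image (Or.inl zero_le_one), NNReal.rpow_one, ENNReal.smul_def,
    smul_eq_mul, ENNReal.ofReal_eq_coe_nnreal (Real.sqrt_nonneg 2)]
  congr 1
  rw [ENNReal.coe_inj]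
  ext
  simp [Real.sqrt_nonneg]

/-- `A ⁻¹' s = ½ • (A '' s)` (`A⁻¹ = A / 2`). [folklore] -/
theorem preimage_klslA_eq_smul (s : Set Momentum) : klslA ⁻¹' s = (2⁻¹ : ℝ) • (klslA '' s) := by
  ext u
  rw [← Set.image_smul, Set.mem_preimage, Set.mem_image]
  constructor
  · intro hu
    refine ⟨klslA (klslA u), ⟨klslA u, hu, rfl⟩, ?_⟩
    rw [klslA_klslA, smul_smul]
    norm_num
  · rintro ⟨_, ⟨v, hv, rfl⟩, rfl⟩
    rw [klslA_smul, klslA_klslA, smul_smul]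
    norm_num
    exact hv

/-- **`A⁻¹` shrinks arc length by `√2`**: `μH[1] (A ⁻¹' s) = (√2)⁻¹ · μH[1] s`. [folklore] -/
theorem hausdorffMeasure_preimage_klslA (s : Set Momentum) :
    μH[1] (klslA ⁻¹' s) = ENNReal.ofReal ((Real.sqrt 2)⁻¹) * μH[1] s := by
  have hs : 0 < Real.sqrt 2 := Real.sqrt_pos.2 two_pos
  rw [preimage_klslA_eq_smul, Measure.hausdorffMeasure_smul₀ zero_le_one (by norm_num : (2⁻¹ : ℝ) ≠ 0),
    hausdorffMeasure_image_klslA, NNReal.rpow_one, ENNReal.smul_def, smul_eq_mul, ← mul_assoc]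
  congr 1
  rw [ENNReal.ofReal_eq_coe_nnreal (Real.sqrt_nonneg 2), ← ENNReal.coe_mul,
    ENNReal.ofReal_eq_coe_nnreal (inv_nonneg.2 hs.le), ENNReal.coe_inj]
  ext
  simp only [NNReal.coe_mul, coe_nnnorm, norm_inv, Real.norm_ofNat, NNReal.coe_mk]
  have h2 : Real.sqrt 2 * Real.sqrt 2 = 2 := Real.mul_self_sqrt (by norm_num : (0:ℝ) ≤ 2)
  field_simp
  nlinarith [h2, Real.sqrt_nonneg 2]

/-- **`A_* μH[1] = (√2)⁻¹ · μH[1]`** on momentum space. [folklore] -/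
theorem map_klslA_hausdorff :
    Measure.map klslA (μH[1] : Measure Momentum) = ENNReal.ofReal ((Real.sqrt 2)⁻¹) • μH[1] := by
  ext s hs
  rw [Measure.map_apply measurable_klslA hs, hausdorffMeasure_preimage_klslA, Measure.smul_apply, smul_eq_mul]

/-- The affine pieces `k ↦ A k + c` halve Lebesgue measure … [folklore] -/
theorem map_klslA_add_volume (c : Momentum) :
    Measure.map (fun k => klslA k + c) (volume : Measure Momentum) = (2 : ℝ≥0∞)⁻¹ • volume := by
  rw [show (fun k => klslA k + c) = (· + c) ∘ klslA from rfl, ← Measure.map_map (measurable_add_const c) measurable_klslA,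
    map_klslA_volume, Measure.map_smul, map_add_right_eq_self]

/-- … and shrink arc length by `√2`. [folklore] -/
theorem map_klslA_add_hausdorff (c : Momentum) :
    Measure.map (fun k => klslA k + c) (μH[1] : Measure Momentum) = ENNReal.ofReal ((Real.sqrt 2)⁻¹) • μH[1] := by
  rw [show (fun k => klslA k + c) = (· + c) ∘ klslA from rfl, ← Measure.map_map (measurable_add_const c) measurable_klslA,
    map_klslA_hausdorff, Measure.map_smul]
  congr 1
  exact (IsometryEquiv.addRight c).map_hausdorffMeasure 1


/-! ### §2 The fold of one coordinate and the folded cover `Φ = fold ∘ A` -/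

/-- The fold of one coordinate back to the period window: `x + 2π` below `-π`, `x` on `[-π, π)`, `x - 2π` from `π` on
(agrees with reduction mod `2π` on `[-3π, 3π)`, which contains every coordinate of `A k`, `k ∈ BZ`). [folklore] -/
def klslWrap (x : ℝ) : ℝ := if x < -π then x + 2 * π else if x < π then x else x - 2 * π

/-- Below the window the fold adds `2π`. [folklore] -/
theorem klslWrap_of_lt {x : ℝ} (h : x < -π) : klslWrap x = x + 2 * π := by simp [klslWrap, h]

/-- On the window the fold is the identity. [folklore] -/
theorem klslWrap_of_mem {x : ℝ} (h1 : -π ≤ x) (h2 : x < π) : klslWrap x = x := by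
  simp [klslWrap, not_lt.2 h1, h2]

/-- Above the window the fold subtracts `2π`. [folklore] -/
theorem klslWrap_of_ge {x : ℝ} (h : π ≤ x) : klslWrap x = x - 2 * π := by
  have h1 : ¬ x < -π := fun h' => by linarith [pi_pos]
  simp [klslWrap, h1, not_lt.2 h]

/-- The fold shifts by a multiple of the period: `cos (fold x + y) = cos (x + y)`. [folklore] -/
theorem cos_klslWrap_add (x y : ℝ) : cos (klslWrap x + y) = cos (x + y) := by
  unfold klslWrap
  split_ifs
  · rw [show x + 2 * π + y = (x + y) + 2 * π by ring, cos_add_two_pi]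
  · rfl
  · rw [show x - 2 * π + y = (x + y) - 2 * π by ring, cos_sub_two_pi]

/-- `cos (fold x) = cos x`. [folklore] -/
theorem cos_klslWrap (x : ℝ) : cos (klslWrap x) = cos x := by simpa using cos_klslWrap_add x 0

/-- `sin (fold x) = sin x`. [folklore] -/
theorem sin_klslWrap (x : ℝ) : sin (klslWrap x) = sin x := by
  unfold klslWrap
  split_ifs
  · rw [sin_add_two_pi]
  · rfl
  · rw [sin_sub_two_pi]

/-- The fold is Borel measurable. [folklore] -/
theorem measurable_klslWrap : Measurable klslWrap := by
  unfold klslWrap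
  refine Measurable.ite (measurableSet_lt measurable_id measurable_const) (measurable_id.add_const _) ?_
  exact Measurable.ite (measurableSet_lt measurable_id measurable_const) measurable_id (measurable_id.sub_const _)

/-- The fold of both coordinates of a momentum. [folklore] -/
def klslFold (u : Momentum) : Momentum := WithLp.toLp 2 ![klslWrap (u 0), klslWrap (u 1)]

/-- First component of the fold. [folklore] -/
@[simp] theorem klslFold_apply_zero (u : Momentum) : klslFold u 0 = klslWrap (u 0) := by simp [klslFold]

/-- Second component of the fold. [folklore] -/
@[simp] theorem klslFold_apply_one (u : Momentum) : klslFold u 1 = klslWrap (u 1) := by simp [klslFold]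

/-- The fold, factored through the measurable equivalence `Momentum ≃ᵐ (Fin 2 → ℝ)`. [folklore] -/
theorem klslFold_eq_comp :
    klslFold = (WithLp.toLp 2) ∘ (fun (a : Fin 2 → ℝ) (i : Fin 2) => klslWrap (a i)) ∘ (WithLp.ofLp) := by
  funext u
  ext i
  fin_cases i <;> simp [klslFold]

/-- The fold is Borel measurable. [folklore] -/
theorem measurable_klslFold : Measurable klslFold := by
  rw [klslFold_eq_comp]
  refine (PiLp.volume_preserving_toLp (Fin 2)).measurable.comp (Measurable.comp ?_ (PiLp.volume_preserving_ofLp (Fin 2)).measurable)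
  exact measurable_pi_iff.2 fun i => measurable_klslWrap.comp (measurable_pi_apply i)

/-- A `2π`-periodic band does not see the fold, even after a further translation:
`ε_{t,t'}(fold u + q) = ε_{t,t'}(u + q)`. [folklore] -/
theorem squareDispersion_klslFold_add (t t' : ℝ) (u q : Momentum) :
    squareDispersion t t' (klslFold u + q) = squareDispersion t t' (u + q) := by
  simp only [squareDispersion, PiLp.add_apply, klslFold_apply_zero, klslFold_apply_one, cos_klslWrap_add]

/-- `ε_{t,t'}(fold u) = ε_{t,t'}(u)`. [folklore] -/
theorem squareDispersion_klslFold (t t' : ℝ) (u : Momentum) :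
    squareDispersion t t' (klslFold u) = squareDispersion t t' u := by
  simpa using squareDispersion_klslFold_add t t' u 0

/-- **The folded sublattice cover** `Φ = fold ∘ A`: a two-to-one self-map of the Brillouin zone. [folklore] -/
def klslCover (k : Momentum) : Momentum := klslFold (klslA k)

/-- `Φ` is Borel measurable. [folklore] -/
theorem measurable_klslCover : Measurable klslCover := measurable_klslFold.comp measurable_klslA

/-! ### §3 The dispersion identity `ε' = ε ∘ A` -/

/-- **The pure `t'` band is the pure `t` band of the sublattice**: `squareDispersion 0 t' k = squareDispersion t' 0 (A k)`
(`-4t' cos k₀ cos k₁ = -2t' (cos (k₀+k₁) + cos (k₀-k₁))`). [folklore] -/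
theorem klsl_squareDispersion_nnn (t' : ℝ) (k : Momentum) :
    squareDispersion 0 t' k = squareDispersion t' 0 (klslA k) := by
  simp only [squareDispersion, klslA_apply_zero, klslA_apply_one, cos_add, cos_sub]
  ring

/-- The normalised case read through the cover: `ε(Φ k) = ε'(k)` with `ε = squareDispersion 1 0`,
`ε' = squareDispersion 0 1`. [folklore] -/
theorem klsl_squareDispersion_cover (k : Momentum) :
    squareDispersion 1 0 (klslCover k) = squareDispersion 0 1 k := by
  rw [klslCover, squareDispersion_klslFold, klsl_squareDispersion_nnn]

/-- … and after a translation by `A q`: `ε(Φ k + A q) = ε'(k + q)`. [folklore] -/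
theorem klsl_squareDispersion_cover_add (k q : Momentum) :
    squareDispersion 1 0 (klslCover k + klslA q) = squareDispersion 0 1 (k + q) := by
  rw [klslCover, squareDispersion_klslFold_add, ← klslA_add, klsl_squareDispersion_nnn]

end Summit.HubbardSuperconductivity.HubbardSuperconductivity.Theorems

end
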